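import Literature.ModelTheory.ExponentialFields.DefinableFamilyClosure
import HarnessLib

/-!
# Closed boxes of a definably complete ordered field are definably compact, in every dimension

Topic `Literature/ModelTheory/ExponentialFields`.  Fornasiero–Servi, *Definably complete Baire
structures*, Fund. Math. 209 (2010), §1.2: in a definably complete expansion `K` of an ordered
field, a definable subset of `Kⁿ` which is closed and bounded is **definably compact** —
Lemma 1.8 (Miller): "`X` is definably compact iff for every definable decreasing family
`(Y(y))_{y ∈ N}` of closed non empty subsets of `X` we have `⋂_y Y(y) ≠ ∅`" — the substitute
for compactness on which their (and Wilkie's) definable analysis in `Kⁿ` rests (Lemmas 1.10–1.16,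
the definable extreme value, Sard and implicit function theorems), hence the whole
Fornasiero–Servi / Jones–Servi route to Macintyre–Wilkie's theorem through the models of the
recursive theory `OEF ∪ [DC]`.  `DefinablyCompleteIntervals.lean` proved the case `X = [a, b]`
(`n = 1`); this file proves it **in all dimensions**, from definable completeness alone:

* **`IsDefinablyComplete.exists_forall_mem_of_antitone_pi`** — a definable family
  `(Y y)_{y ∈ N}` of closed non-empty subsets of a box `[a, b]ⁿ ⊆ Kⁿ`, decreasing along a
  non-empty definable `N ⊆ K`, has a common point.  Induction on `n`: with `m_y = inf` of the
  first coordinates of `Y y` (attained: by the inductive hypothesis applied to the closures of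
  the projections of the slices `Y y ∩ {x₀ ≤ t}`, `t ↓ m_y`, the point `(m_y, x')` lies in the
  closed set `Y y`), the supremum `c = sup_y m_y` and a common point `x*` of the closures of the
  projections of `Y y ∩ {x₀ ≤ c}` (inductive hypothesis again) give the common point `(c, x*)`;
* **`IsDefinablyComplete.exists_forall_le_of_continuousOn_pi`** — the *extreme value theorem*
  in `Kⁿ` (Fornasiero–Servi 2010, Lemma 1.16 (Miller), real-valued case): a continuous function
  with definable graph attains its maximum on every non-empty closed bounded definable set
  (the superlevel sets form a decreasing definable family of closed sets).

Everything is proved; no definitions.  Conventions: `hlt`, `hadd` (graphs of `<`, `+`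
definable), families coded as in `DefinableFamilyClosure.lean`.

## References

* A. Fornasiero, T. Servi, *Definably complete Baire structures*, Fund. Math. 209 (2010),
  Definition 1.6, Lemma 1.8, Lemma 1.16. [FornasieroServi2010]
* C. Miller, *Expansions of dense linear orders with the intermediate value property*,
  J. Symbolic Logic 66 (2001). [Miller2001]
-/

open Set FirstOrder FirstOrder.Language
open _root_.Filter _root_.Topology

namespace Literature.ModelTheory.ExponentialFields

universe u v

variable {K : Type*} [Field K] [LinearOrder K] [IsStrictOrderedRing K] [TopologicalSpace K]
  [OrderTopology K] {L : FirstOrder.Language.{u, v}} [L.Structure K]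

omit [Field K] [IsStrictOrderedRing K] [L.Structure K] in
/-- Closed boxes `{x | ∀ i, a ≤ xᵢ ≤ b}` of `Kⁿ` are closed. [folklore] -/
theorem isClosed_box {n : ℕ} (a b : K) :
    IsClosed {x : Fin n → K | ∀ i, a ≤ x i ∧ x i ≤ b} := by
  have h : {x : Fin n → K | ∀ i, a ≤ x i ∧ x i ≤ b} = ⋂ i, (fun x => x i) ⁻¹' Icc a b := by
    ext x; simp
  rw [h]
  exact isClosed_iInter fun i => isClosed_Icc.preimage (continuous_apply i)

omit [Field K] [TopologicalSpace K] [OrderTopology K] [LinearOrder K] [IsStrictOrderedRing K] in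
/-- `Fin.tail` is a definable map. [folklore] -/
theorem definableMap_tail {n : ℕ} :
    (univ : Set K).DefinableMap L (fun v : Fin (n + 1) → K => Fin.tail v) := fun i =>
  definableFun_proj_params (L := L) (A := (univ : Set K)) i.succ

/-- **Closed boxes are definably compact, in every dimension** (Fornasiero–Servi 2010,
Lemma 1.8 (Miller), for `X = [a, b]ⁿ`, whence for every closed bounded definable `X ⊆ Kⁿ`): in a
definably complete ordered field with `<` and `+` definable, a definable family `(Y y)_{y ∈ N}`
of closed non-empty subsets of `[a, b]ⁿ`, decreasing along the non-empty definable index set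
`N ⊆ K`, has a common point. [cite: FornasieroServi2010, Lemma 1.8] -/
theorem _root_.FirstOrder.Language.IsDefinablyComplete.exists_forall_mem_of_antitone_pi
    (hDC : L.IsDefinablyComplete K)
    (hlt : (univ : Set K).Definable L {v : Fin 2 → K | v 0 < v 1})
    (hadd : (univ : Set K).Definable L {v : Fin 3 → K | v 2 = v 0 + v 1}) :
    ∀ (n : ℕ) {N : Set K} (_ : (univ : Set K).Definable₁ L N) (_ : N.Nonempty)
      {Y : K → Set (Fin n → K)}
      (_ : (univ : Set K).Definable L {v : Fin (n + 1) → K | Fin.tail v ∈ Y (v 0)})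
      (_ : ∀ y ∈ N, ∀ y' ∈ N, y ≤ y' → Y y' ⊆ Y y)
      (_ : ∀ y ∈ N, IsClosed (Y y)) (_ : ∀ y ∈ N, (Y y).Nonempty)
      {a b : K} (_ : ∀ y ∈ N, ∀ x ∈ Y y, ∀ i, a ≤ x i ∧ x i ≤ b),
      ∃ x, ∀ y ∈ N, x ∈ Y y := by
  intro n
  induction n with
  | zero =>
    intro N _ _ Y _ _ _ hne a b _
    refine ⟨fun i => i.elim0, fun y hy => ?_⟩
    obtain ⟨z, hz⟩ := hne y hy
    rwa [Subsingleton.elim (fun i : Fin 0 => (i.elim0 : K)) z]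
  | succ n ih =>
    intro N hN hNne Y hY hanti hcl hne a b hsub
    classical
    /- the first-coordinate sets `D y = {x 0 | x ∈ Y y}` and their infima `m y` -/
    set D : K → Set K := fun y => (fun x : Fin (n + 1) → K => x 0) '' (Y y) with hD
    have hDdef : ∀ y, (univ : Set K).Definable₁ L (D y) := fun y =>
      definable₁_image_eval (n := n) (S := Y y) (definable_fibre (n := n + 1) (Y := Y) hY y) 0
    have hDne : ∀ y ∈ N, (D y).Nonempty := fun y hy => (hne y hy).image _
    have hDbdd : ∀ y ∈ N, BddBelow (D y) := fun y hy =>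
      ⟨a, by rintro _ ⟨x, hx, rfl⟩; exact (hsub y hy x hx 0).1⟩
    have hglb : ∀ y ∈ N, ∃ m, IsGLB (D y) m := fun y hy =>
      hDC.exists_isGLB_of_definable_lt hlt (hDdef y) (hDne y hy) (hDbdd y hy)
    choose! m hm using hglb
    -- membership in `D` through `Fin.cons`
    have hmemD : ∀ y t, t ∈ D y ↔ ∃ x' : Fin n → K, (Fin.cons t x' : Fin (n + 1) → K) ∈ Y y := by
      intro y t
      constructor
      · rintro ⟨x, hx, rfl⟩
        exact ⟨Fin.tail x, by rwa [Fin.cons_self_tail]⟩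
      · rintro ⟨x', hx'⟩
        exact ⟨_, hx', by simp⟩
    -- `m y ≤ x 0` on `Y y`, and a point of `Y y` with first coordinate `≤ t` whenever `m y < t`
    have hmle : ∀ y ∈ N, ∀ x ∈ Y y, m y ≤ x 0 := fun y hy x hx => (hm y hy).1 ⟨x, hx, rfl⟩
    have hexlt : ∀ y ∈ N, ∀ t, m y < t → ∃ x ∈ Y y, x 0 < t := by
      intro y hy t ht
      obtain ⟨_, ⟨x, hx, rfl⟩, -, hxt⟩ := (hm y hy).exists_between ht
      exact ⟨x, hx, hxt⟩
    -- the graph of negation and of the identity are definable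
    have hid : (univ : Set K).Definable L {v : Fin 2 → K | v 1 = (fun s => s) (v 0)} :=
      definable_setOf_eq_params (definableFun_proj_params 1) (definableFun_proj_params 0)
    have hneg : (univ : Set K).Definable L {v : Fin 2 → K | v 1 = (fun s => -s) (v 0)} :=
      definable_graph_neg hadd (f := fun s => s) hid
    -- boxes are preserved by tails and closures
    have htail_box : ∀ (S : Set (Fin (n + 1) → K)), (∀ x ∈ S, ∀ i, a ≤ x i ∧ x i ≤ b) →
        ∀ z ∈ closure (Fin.tail '' S), ∀ i, a ≤ z i ∧ z i ≤ b := by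
      intro S hS z hz
      have hsub' : Fin.tail '' S ⊆ {z : Fin n → K | ∀ i, a ≤ z i ∧ z i ≤ b} := by
        rintro _ ⟨x, hx, rfl⟩ i
        exact hS x hx i.succ
      exact (closure_minimal hsub' (isClosed_box a b)) hz
    /- Step 1: the infimum `m y` is attained: `(m y, x') ∈ Y y` for some `x'` -/
    have hattain : ∀ y ∈ N, ∃ x' : Fin n → K, (Fin.cons (m y) x' : Fin (n + 1) → K) ∈ Y y := by
      intro y hy
      -- the family `V s = closure (tail '' (Y y ∩ {x 0 ≤ -s}))`, `s < -m y`, decreasing in `s`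
      set V : K → Set (Fin n → K) :=
        fun s => closure (Fin.tail '' (Y y ∩ {x | x 0 ≤ (fun s => -s) s})) with hV
      have hY₀ := definable_family_const (L := L) (n := n + 1) (S := Y y)
        (definable_fibre (n := n + 1) (Y := Y) hY y)
      have hV₁ := definable_family_inter_le (n := n) (Y := fun _ : K => Y y) (g := fun s => -s)
        hlt hY₀ hneg
      have hV₂ := definable_family_tail_image (n := n)
        (Y := fun s => Y y ∩ {x | x 0 ≤ (fun s => -s) s}) hV₁
      have hVdef := definable_family_closure (n := n)
        (W := fun s => Fin.tail '' (Y y ∩ {x | x 0 ≤ (fun s => -s) s})) hlt hV₂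
      set N' : Set K := {s | s < -m y} with hN'
      have hN'def : (univ : Set K).Definable₁ L N' := by
        have h : (univ : Set K).Definable L {v : Fin 1 → K | v 0 < -m y} :=
          definable_setOf_lt_params hlt (definableFun_proj_params 0)
            (definableFun_const_params _ (mem_univ _))
        simpa [Set.Definable₁, hN'] using h
      have hN'ne : N'.Nonempty := exists_lt (-m y)
      have hVanti : ∀ s ∈ N', ∀ s' ∈ N', s ≤ s' → V s' ⊆ V s := by
        intro s _ s' _ hss'
        refine closure_mono (image_mono fun x hx => ⟨hx.1, ?_⟩)
        exact le_trans (b := -s') hx.2 (neg_le_neg hss')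
      have hVcl : ∀ s ∈ N', IsClosed (V s) := fun _ _ => isClosed_closure
      have hVne : ∀ s ∈ N', (V s).Nonempty := by
        intro s hs
        have hlt' : m y < -s := by
          have := neg_lt_neg hs; rwa [neg_neg] at this
        obtain ⟨x, hx, hxs⟩ := hexlt y hy (-s) hlt'
        exact ⟨Fin.tail x, subset_closure ⟨x, ⟨hx, hxs.le⟩, rfl⟩⟩
      have hVsub : ∀ s ∈ N', ∀ z ∈ V s, ∀ i, a ≤ z i ∧ z i ≤ b := fun s _ z hz =>
        htail_box _ (fun x hx i => hsub y hy x hx.1 i) z hz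
      obtain ⟨x', hx'⟩ := ih (N := N') (Y := V) hN'def hN'ne hVdef hVanti hVcl hVne hVsub
      refine ⟨x', ?_⟩
      -- `(m y, x')` lies in the closure of `Y y`
      rw [← (hcl y hy).closure_eq, mem_closure_iff_forall_box]
      intro l u hlu
      have h0 := hlu 0
      simp only [Fin.cons_zero] at h0
      obtain ⟨c, hmc, hcu⟩ := exists_between h0.2
      have hcN' : -c ∈ N' := by
        show -c < -m y
        exact neg_lt_neg hmc
      have hx'c := hx' (-c) hcN'
      simp only [hV, neg_neg] at hx'c
      rw [mem_closure_iff_forall_box] at hx'c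
      obtain ⟨z, ⟨x, ⟨hxY, hxc⟩, rfl⟩, hz⟩ := hx'c (Fin.tail l) (Fin.tail u) fun i => by
        have := hlu i.succ
        simp only [Fin.cons_succ] at this
        exact this
      refine ⟨x, hxY, fun i => ?_⟩
      refine Fin.cases ?_ (fun j => ?_) i
      · exact ⟨h0.1.trans_le (hmle y hy x hxY), lt_of_le_of_lt hxc hcu⟩
      · exact hz j
    /- Step 2: `m` is monotone on `N`; its supremum `c` -/
    have hmono : ∀ y ∈ N, ∀ y' ∈ N, y ≤ y' → m y ≤ m y' := by
      intro y hy y' hy' hyy'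
      refine (hm y' hy').2 fun t ht => ?_
      obtain ⟨x, hx, rfl⟩ := ht
      exact hmle y hy x (hanti y hy y' hy' hyy' hx)
    have hmmem : ∀ y ∈ N, m y ∈ D y := fun y hy => (hmemD y (m y)).2 (hattain y hy)
    have hmleb : ∀ y ∈ N, m y ≤ b := by
      intro y hy
      obtain ⟨x, hx, hx0⟩ := hmmem y hy
      rw [← hx0]
      exact (hsub y hy x hx 0).2
    -- the definable set of the infima
    set G : Set K := {t | ∃ y, y ∈ N ∧ IsGLB (D y) t} with hG
    have hR := definable_firstCoord_rel (n := n) (Y := Y) hY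
    have hGdef : (univ : Set K).Definable₁ L G := by
      have hrel : (univ : Set K).Definable L {v : Fin 2 → K | v 1 ∈ D (v 0)} := by
        refine (congrArg _ ?_).mpr hR
        ext v
        exact hmemD (v 0) (v 1)
      have h : (univ : Set K).Definable L
          {v : Fin 1 → K | ∃ y, y ∈ N ∧ ((∀ w, w ∈ D y → v 0 ≤ w) ∧
            ∀ t', (∀ w, w ∈ D y → t' ≤ w) → t' ≤ v 0)} := by
        refine definable_setOf_exists_params (definable_setOf_and_params ?_
          (definable_setOf_and_params
            (definable_setOf_forall_params (definable_setOf_imp_params ?_ ?_))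
            (definable_setOf_forall_params (definable_setOf_imp_params
              (definable_setOf_forall_params (definable_setOf_imp_params ?_ ?_)) ?_))))
        · simpa [Set.Definable₁] using hN.preimage_comp (α := Fin 1) (β := Fin 1 ⊕ Unit)
            (fun _ => Sum.inr ())
        · exact definable_setOf_rel_params (r := fun y w => w ∈ D y) hrel
            (definableFun_proj_params _) (definableFun_proj_params _)
        · exact definable_setOf_le_params hlt (definableFun_proj_params _)
            (definableFun_proj_params _)
        · exact definable_setOf_rel_params (r := fun y w => w ∈ D y) hrel
            (definableFun_proj_params _) (definableFun_proj_params _)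
        · exact definable_setOf_le_params hlt (definableFun_proj_params _)
            (definableFun_proj_params _)
        · exact definable_setOf_le_params hlt (definableFun_proj_params _)
            (definableFun_proj_params _)
      simpa [Set.Definable₁, hG, IsGLB, IsGreatest, mem_lowerBounds, mem_upperBounds] using h
    obtain ⟨y₁, hy₁⟩ := hNne
    have hGne : G.Nonempty := ⟨m y₁, y₁, hy₁, hm y₁ hy₁⟩
    have hGbdd : BddAbove G := by
      refine ⟨b, fun t ⟨y, hy, ht⟩ => ?_⟩
      rw [ht.unique (hm y hy)]
      exact hmleb y hy
    obtain ⟨c, hc⟩ := hDC G hGdef hGne hGbdd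
    have hmlec : ∀ y ∈ N, m y ≤ c := fun y hy => hc.1 ⟨y, hy, hm y hy⟩
    have hexm : ∀ l₀, l₀ < c → ∃ y ∈ N, l₀ < m y := by
      intro l₀ hl₀
      obtain ⟨t, ⟨y, hy, ht⟩, hl₀t, -⟩ := hc.exists_between hl₀
      refine ⟨y, hy, ?_⟩
      rwa [ht.unique (hm y hy)] at hl₀t
    /- Step 3: the family `H y = closure (tail '' (Y y ∩ {x 0 ≤ c}))` on `N` -/
    set H : K → Set (Fin n → K) :=
      fun y => closure (Fin.tail '' (Y y ∩ {x | x 0 ≤ (fun _ => c) y})) with hH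
    have hconst : (univ : Set K).Definable L {v : Fin 2 → K | v 1 = (fun _ : K => c) (v 0)} :=
      definable_setOf_eq_params (definableFun_proj_params 1)
        (definableFun_const_params _ (mem_univ c))
    have hHdef := definable_family_closure (n := n)
      (W := fun y => Fin.tail '' (Y y ∩ {x | x 0 ≤ (fun _ => c) y})) hlt
      (definable_family_tail_image (n := n) (Y := fun y => Y y ∩ {x | x 0 ≤ (fun _ => c) y})
        (definable_family_inter_le (n := n) (Y := Y) (g := fun _ => c) hlt hY hconst))
    have hHanti : ∀ y ∈ N, ∀ y' ∈ N, y ≤ y' → H y' ⊆ H y := fun y hy y' hy' hyy' =>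
      closure_mono (image_mono fun x hx => ⟨hanti y hy y' hy' hyy' hx.1, hx.2⟩)
    have hHcl : ∀ y ∈ N, IsClosed (H y) := fun _ _ => isClosed_closure
    have hHne : ∀ y ∈ N, (H y).Nonempty := by
      intro y hy
      obtain ⟨x', hx'⟩ := hattain y hy
      refine ⟨x', subset_closure ⟨Fin.cons (m y) x', ⟨hx', ?_⟩, Fin.tail_cons _ _⟩⟩
      show (Fin.cons (m y) x' : Fin (n + 1) → K) 0 ≤ c
      rw [Fin.cons_zero]
      exact hmlec y hy
    have hHsub : ∀ y ∈ N, ∀ z ∈ H y, ∀ i, a ≤ z i ∧ z i ≤ b := fun y hy z hz =>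
      htail_box _ (fun x hx i => hsub y hy x hx.1 i) z hz
    obtain ⟨xs, hxs⟩ := ih (N := N) (Y := H) hN ⟨y₁, hy₁⟩ hHdef hHanti hHcl hHne hHsub
    /- Step 4: `(c, xs)` is a common point -/
    refine ⟨Fin.cons c xs, fun y₀ hy₀ => ?_⟩
    rw [← (hcl y₀ hy₀).closure_eq, mem_closure_iff_forall_box]
    intro l u hlu
    have h0 := hlu 0
    simp only [Fin.cons_zero] at h0
    -- an index `y ≥ y₀` in `N` with `l 0 < m y`
    obtain ⟨y₂, hy₂, hly₂⟩ := hexm (l 0) h0.1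
    obtain ⟨y, hy, hy₀y, hly⟩ : ∃ y ∈ N, y₀ ≤ y ∧ l 0 < m y := by
      rcases le_total y₀ y₂ with h | h
      · exact ⟨y₂, hy₂, h, hly₂⟩
      · exact ⟨y₀, hy₀, le_rfl, hly₂.trans_le (hmono y₂ hy₂ y₀ hy₀ h)⟩
    have hxsy := hxs y hy
    simp only [hH] at hxsy
    rw [mem_closure_iff_forall_box] at hxsy
    obtain ⟨z, ⟨x, ⟨hxY, hxc⟩, rfl⟩, hz⟩ := hxsy (Fin.tail l) (Fin.tail u) fun i => by
      have := hlu i.succ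
      simp only [Fin.cons_succ] at this
      exact this
    refine ⟨x, hanti y₀ hy₀ y hy hy₀y hxY, fun i => ?_⟩
    refine Fin.cases ?_ (fun j => ?_) i
    · exact ⟨hly.trans_le (hmle y hy x hxY), lt_of_le_of_lt hxc h0.2⟩
    · exact hz j

/-! ### The extreme value theorem in `Kⁿ` -/

/-- **Definable extreme value theorem in `Kⁿ`** (Fornasiero–Servi 2010, Lemma 1.16 (Miller),
for `K`-valued functions): in a definably complete ordered field with `<`, `+` definable, a
definable function `f : Kⁿ → K`, continuous on a non-empty closed bounded definable set `X`,
attains its maximum on `X`.  (The superlevel sets `{x ∈ X | t ≤ f x}`, `t ∈ f(X)`, form a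
decreasing definable family of closed non-empty subsets of a box; a common point is a maximum
point.) [cite: FornasieroServi2010, Lemma 1.16] -/
theorem _root_.FirstOrder.Language.IsDefinablyComplete.exists_forall_le_of_continuousOn_pi
    (hDC : L.IsDefinablyComplete K)
    (hlt : (univ : Set K).Definable L {v : Fin 2 → K | v 0 < v 1})
    (hadd : (univ : Set K).Definable L {v : Fin 3 → K | v 2 = v 0 + v 1})
    {n : ℕ} {X : Set (Fin n → K)} (hX : (univ : Set K).Definable L X) (hXcl : IsClosed X)
    (hXne : X.Nonempty) {a b : K} (hXsub : ∀ x ∈ X, ∀ i, a ≤ x i ∧ x i ≤ b)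
    {f : (Fin n → K) → K} (hf : (univ : Set K).DefinableFun L f) (hcont : ContinuousOn f X) :
    ∃ x ∈ X, ∀ x' ∈ X, f x' ≤ f x := by
  -- the superlevel family `Y t = {x ∈ X | t ≤ f x}` over `N = f '' X`
  set Y : K → Set (Fin n → K) := fun t => X ∩ {x | t ≤ f x} with hY
  set N : Set K := f '' X with hN
  have hftail : (univ : Set K).DefinableFun L (fun v : Fin (n + 1) → K => f (Fin.tail v)) :=
    hf.comp definableMap_tail
  have hYdef : (univ : Set K).Definable L {v : Fin (n + 1) → K | Fin.tail v ∈ Y (v 0)} := by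
    have h := (definable_family_const (L := L) (n := n) (S := X) hX).inter
      (definable_setOf_le_params hlt (definableFun_proj_params 0) hftail)
    refine (congrArg _ ?_).mpr h
    ext v
    simp [hY]
  have hNdef : (univ : Set K).Definable₁ L N := by
    -- `N = {t | ∃ x ∈ X, f x = t}`: project the graph
    have hgraph : (univ : Set K).Definable L {v : Fin (n + 1) → K | Fin.tail v ∈ X ∧ v 0 = f (Fin.tail v)} :=
      (definable_family_const (L := L) (n := n) (S := X) hX).inter
        (definable_setOf_eq_params (definableFun_proj_params 0) hftail)
    have h := hgraph.image_comp (fun _ : Fin 1 => (0 : Fin (n + 1)))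
    rw [Set.Definable₁]
    refine (congrArg _ ?_).mpr h
    ext v
    simp only [mem_setOf_eq, mem_image, hN]
    constructor
    · rintro ⟨x, hx, hxv⟩
      refine ⟨Fin.cons (f x) x, ⟨by simpa using hx, by simp⟩, ?_⟩
      funext j
      rw [Subsingleton.elim j 0]
      simpa using hxv
    · rintro ⟨w, ⟨hwX, hw0⟩, rfl⟩
      exact ⟨Fin.tail w, hwX, by simp [hw0]⟩
  obtain ⟨x₀, hx₀⟩ := hXne
  have hNne : N.Nonempty := ⟨f x₀, x₀, hx₀, rfl⟩
  have hanti : ∀ t ∈ N, ∀ t' ∈ N, t ≤ t' → Y t' ⊆ Y t := fun t _ t' _ htt' x hx =>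
    ⟨hx.1, htt'.trans hx.2⟩
  have hcl : ∀ t ∈ N, IsClosed (Y t) := fun t _ =>
    hcont.preimage_isClosed_of_isClosed hXcl isClosed_Ici
  have hne : ∀ t ∈ N, (Y t).Nonempty := by
    rintro _ ⟨x, hx, rfl⟩
    exact ⟨x, hx, le_rfl⟩
  have hsub : ∀ t ∈ N, ∀ x ∈ Y t, ∀ i, a ≤ x i ∧ x i ≤ b := fun t _ x hx => hXsub x hx.1
  obtain ⟨x, hx⟩ := hDC.exists_forall_mem_of_antitone_pi hlt hadd n (N := N) (Y := Y) hNdef hNne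
    hYdef hanti hcl hne hsub
  have hxX : x ∈ X := (hx (f x₀) ⟨x₀, hx₀, rfl⟩).1
  exact ⟨x, hxX, fun x' hx' => (hx (f x') ⟨x', hx', rfl⟩).2⟩

/-- **Definable extreme value theorem in `Kⁿ`, minimum.** [cite: FornasieroServi2010, Lemma 1.16] -/
theorem _root_.FirstOrder.Language.IsDefinablyComplete.exists_forall_ge_of_continuousOn_pi
    (hDC : L.IsDefinablyComplete K)
    (hlt : (univ : Set K).Definable L {v : Fin 2 → K | v 0 < v 1})
    (hadd : (univ : Set K).Definable L {v : Fin 3 → K | v 2 = v 0 + v 1})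
    {n : ℕ} {X : Set (Fin n → K)} (hX : (univ : Set K).Definable L X) (hXcl : IsClosed X)
    (hXne : X.Nonempty) {a b : K} (hXsub : ∀ x ∈ X, ∀ i, a ≤ x i ∧ x i ≤ b)
    {f : (Fin n → K) → K} (hf : (univ : Set K).DefinableFun L f) (hcont : ContinuousOn f X) :
    ∃ x ∈ X, ∀ x' ∈ X, f x ≤ f x' := by
  have hid : (univ : Set K).Definable L {v : Fin 2 → K | v 1 = (fun s => s) (v 0)} :=
    definable_setOf_eq_params (definableFun_proj_params 1) (definableFun_proj_params 0)
  have hneg : (univ : Set K).Definable L {v : Fin 2 → K | v 1 = (fun s => -s) (v 0)} :=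
    definable_graph_neg hadd (f := fun s => s) hid
  have hnegf : (univ : Set K).DefinableFun L (fun v => -f v) :=
    definableFun_apply_params (f := fun s => -s) hneg hf
  obtain ⟨x, hx, hmax⟩ := hDC.exists_forall_le_of_continuousOn_pi hlt hadd hX hXcl hXne hXsub
    hnegf hcont.neg
  exact ⟨x, hx, fun x' hx' => neg_le_neg_iff.1 (hmax x' hx')⟩

/-- **Continuous definable functions are bounded on closed bounded definable sets** of `Kⁿ`
(Fornasiero–Servi 2010, Lemma 1.16 (Miller): the image of a definably compact set is definably
compact; here its boundedness). [cite: FornasieroServi2010, Lemma 1.16] -/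
theorem _root_.FirstOrder.Language.IsDefinablyComplete.bddAbove_bddBelow_image_of_continuousOn_pi
    (hDC : L.IsDefinablyComplete K)
    (hlt : (univ : Set K).Definable L {v : Fin 2 → K | v 0 < v 1})
    (hadd : (univ : Set K).Definable L {v : Fin 3 → K | v 2 = v 0 + v 1})
    {n : ℕ} {X : Set (Fin n → K)} (hX : (univ : Set K).Definable L X) (hXcl : IsClosed X)
    {a b : K} (hXsub : ∀ x ∈ X, ∀ i, a ≤ x i ∧ x i ≤ b)
    {f : (Fin n → K) → K} (hf : (univ : Set K).DefinableFun L f) (hcont : ContinuousOn f X) :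
    BddAbove (f '' X) ∧ BddBelow (f '' X) := by
  rcases X.eq_empty_or_nonempty with rfl | hXne
  · simp
  obtain ⟨x₁, -, h₁⟩ := hDC.exists_forall_le_of_continuousOn_pi hlt hadd hX hXcl hXne hXsub hf hcont
  obtain ⟨x₂, -, h₂⟩ := hDC.exists_forall_ge_of_continuousOn_pi hlt hadd hX hXcl hXne hXsub hf hcont
  exact ⟨⟨f x₁, by rintro _ ⟨x, hx, rfl⟩; exact h₁ x hx⟩, ⟨f x₂, by rintro _ ⟨x, hx, rfl⟩; exact h₂ x hx⟩⟩

end Literature.ModelTheory.ExponentialFields
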